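import Literature.NumberTheory.Automorphic.HeckeTransversalGL
import Literature.NumberTheory.Automorphic.HeckeGelfandTrick
import HarnessLib

/-!
# Lattice counts for the Hecke operators of `GL_n`: cosets of `K t_r K` above an integral matrix

Topic `NumberTheory/Automorphic`; theorems only (no definition, no named fact), on top of
`HeckeTransversalGL` (the explicit transversal `{u_a ϖ^{ε_S}}` of `K t_r K / K`, `K = GL_n(𝒪)`,
`t_r = diag(ϖ 1_r, 1_{n-r})`, indexed by reduced echelon data `(S, ā)` over the residue field
`𝓀`) and `ReducedEchelonBasis`. This is the first half of the proof of **Tamagawa's rationality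
theorem for the Hecke series of `GL_n`** (Shimura, *Introduction to the arithmetic theory of
automorphic functions* (1971), Thm. 3.21; Tamagawa (1963)), completed in
`TamagawaHeckeSeries`: the translation of the structure constants of the Hecke ring into counts
of subspaces of `𝓀ⁿ` (Shimura, Prop. 3.15 and the proof of Lemma 3.22), over an arbitrary field
`F` with a valuation (`ValuativeRel`) with finite residue field and a uniformizing element `ϖ`.

## Main statements (all proved)

* `isIntegralMatrix_inv_heckeRepMatrix_mul_iff` (**integrality criterion**): for reduced
  echelon data `(S, ā)` and a matrix `w₀` over `𝒪`, `rep(S, ā)⁻¹ w₀` is integral iff every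
  column of the residue matrix `w̄₀` lies in the span of the echelon vectors `v_j`, `j ∈ S` — in
  lattice terms, `w₀ 𝒪ⁿ ⊆ y 𝒪ⁿ` iff `w̄₀` lands in `y 𝒪ⁿ / ϖ 𝒪ⁿ ≤ 𝓀ⁿ` (`mem_span_echelonVec_iff`
  is the converse of `echelonMatrix_neg_mulVec_apply_eq_zero`).
* `bijective_transversalIndex_span`: reduced echelon data with `#S = n - r` ↔ subspaces of `𝓀ⁿ`
  of dimension `n - r` (existence and uniqueness of reduced echelon bases).
* `ncard_orbit_heckeDiag_isIntegralMatrix` (**the lattice count**): for an integral `w ∈ GL_n(F)`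
  the cosets `y K ⊆ K t_r K` with `y⁻¹ w` integral are equinumerous with the subspaces
  `Y ≤ 𝓀ⁿ`, `dim Y = n - r`, containing the column space `C(w̄₀)` of the residue matrix — the
  count `μ(d) = #{M : N ⊆ M ⊆ L, L/M ≅ 𝔽^i}` of Shimura's proof of Lemma 3.22.
* Determinant-valuation bookkeeping for `Δ_m = {y integral : |det y| = |ϖ|^m}` (stated with the
  defining conjunction; the set itself is named `glIntDet` in `TamagawaHeckeSeries`): stability
  under `K` on both sides, `Δ_0 = K`, `K t_r K ⊆ Δ_r`, `Δ_i Δ_j ⊆ Δ_{i+j}`, integral quotients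
  `y⁻¹ w ∈ Δ_j` for `y ∈ Δ_i`, `w ∈ Δ_{i+j}` (`inv_mul_mem_delta`), no integral quotient when
  `|det y| < |det w|` (`not_isIntegralMatrix_inv_mul`), and **singularity of the residue**
  (`span_cols_residue_ne_top`: for `w ∈ Δ_m`, `m ≥ 1`, the columns of `w̄₀` span a proper
  subspace, as `det w̄₀ = 0`).
* The **Hecke polynomial in Satake form** (pure algebra, for the final form of Tamagawa's
  identity): `∏_{b ∈ s} (1 ± b X) = ∑_j (±1)^j e_j(s) X^j`
  (`multiset_prod_one_add_C_mul_X_eq_sum_esymm`, `multiset_prod_one_sub_C_mul_X_eq_sum_esymm`,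
  the reciprocal form of Mathlib's `Multiset.prod_X_add_C_eq_sum_esymm`) and
  `heckePolynomial_eq_prod_one_sub`:
  `∑_{i=0}^{n} (-1)^i q^{i(i-1)/2} (q^{i(n-i)/2} e_i(α)) X^i = ∏_{a ∈ α} (1 - q^{(n-1)/2} a X)` for
  `#α = n` (the reciprocal of the tree's named fact `heckePolynomial_eq_satakePolynomial` of
  `SatakeParametersGL`; Tamagawa (1963)).

## References

* G. Shimura, *Introduction to the arithmetic theory of automorphic functions*, Publ. Math. Soc.
  Japan 11 (1971), §3.1 (Prop. 3.15: structure constants as numbers of intermediate lattices),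
  §3.2 (Prop. 3.18, Lemma 3.22, Thm. 3.21, Remark 3.25 for the local field case) — read in the
  1973 printing held in the literature store
  (`book:shimura1973-introduction-arithmetic-theory-automorphic-functions`, PDF pp. 78–83)
  [ShimuraIATAF1971].
* T. Tamagawa, *On the ζ-functions of a division algebra*, Ann. of Math. 77 (1963), 387–405
  [TamagawaAnnals1963].
-/

noncomputable section

open scoped Pointwise
open MulAction ValuativeRel Matrix Finset Literature.LinearAlgebra.Matrix.Echelon
  Literature.NumberTheory.Automorphic.Echelon

namespace Literature.NumberTheory.Automorphic

variable {F : Type*} [Field F] [ValuativeRel F] {n : ℕ}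

/-! ### Membership in the span of the echelon vectors -/

/-- A vector lies in the span of the echelon vectors `v_j`, `j ∈ S`, iff its image under
`u_{-ā}` is supported on the pivot set `S` (the converse of
`echelonMatrix_neg_mulVec_apply_eq_zero`: `x = u_ā (u_{-ā} x) = ∑_{j ∈ S} (u_{-ā} x)_j v_j`).
[folklore] -/
theorem mem_span_echelonVec_iff {S : Finset (Fin n)} {ā : Fin n → Fin n → 𝓀[F]}
    (h : IsEchelonData S ā) (x : Fin n → 𝓀[F]) :
    x ∈ Submodule.span 𝓀[F] (echelonVec ā '' (S : Set (Fin n))) ↔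
      ∀ i ∉ S, (echelonMatrix (-ā) *ᵥ x) i = 0 := by
  refine ⟨fun hx i hi => echelonMatrix_neg_mulVec_apply_eq_zero h hx hi, fun hx => ?_⟩
  set y := echelonMatrix (-ā) *ᵥ x with hy
  have hxy : x = echelonMatrix ā *ᵥ y := by
    rw [hy, Matrix.mulVec_mulVec, echelonMatrix_mul_neg h.isEchelonSupported, Matrix.one_mulVec]
  rw [hxy, mem_span_image_iff]
  refine ⟨y, ?_⟩
  have hy' : y = ∑ j ∈ S, y j • (Pi.single j 1 : Fin n → 𝓀[F]) := by
    ext i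
    simp only [Finset.sum_apply, Pi.smul_apply, Pi.single_apply, smul_eq_mul, mul_ite, mul_one,
      mul_zero, Finset.sum_ite_eq]
    split_ifs with hi
    · rfl
    · exact hx i hi
  conv_rhs => rw [hy', Matrix.mulVec_sum]
  refine Finset.sum_congr rfl fun j _ => ?_
  rw [Matrix.mulVec_smul, echelonMatrix_mulVec_single]

/-! ### The integrality criterion for `rep(S, ā)⁻¹ w` -/

/-- For `x ∈ 𝒪`: `ϖ⁻¹ x ∈ 𝒪` iff the residue of `x` vanishes. [folklore] -/
theorem IsUniformizingElement.inv_mul_mem_iff {ϖ : F} (hϖ : IsUniformizingElement ϖ) (x : 𝒪[F]) :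
    ϖ⁻¹ * (x : F) ∈ 𝒪[F] ↔ IsLocalRing.residue 𝒪[F] x = 0 := by
  constructor
  · intro h
    apply residue_eq_zero_of_valuation_lt_one
    have hx : (x : F) = ϖ * (ϖ⁻¹ * (x : F)) := by
      rw [← mul_assoc, mul_inv_cancel₀ hϖ.ne_zero, one_mul]
    rw [hx, map_mul]
    calc valuation F ϖ * valuation F (ϖ⁻¹ * (x : F))
        ≤ valuation F ϖ * 1 := by
          gcongr
          exact (Valuation.mem_integer_iff _ _).mp h
      _ < 1 := by rw [mul_one]; exact hϖ.valuation_lt_one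
  · intro h
    exact hϖ.inv_mul_mem x.2 (valuation_lt_one_of_residue_eq_zero h)

/-- **Integrality criterion.** For reduced echelon data `(S, ā)` over the residue field and a
matrix `w₀` over `𝒪`: `rep(S, ā)⁻¹ w₀ = ϖ^{-ε_S} u_{-a} w₀` is integral iff every column of
the residue matrix `w̄₀` lies in the span of the echelon vectors `v_j`, `j ∈ S` (the rows
`i ∉ S` of `u_{-a} w₀` must be divisible by `ϖ`, i.e. `u_{-ā} w̄₀` is supported on the rows in
`S`). In lattice terms: `w₀ 𝒪ⁿ ⊆ rep(S, ā) 𝒪ⁿ` iff the image of `w₀` modulo `ϖ` lies in the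
subspace `rep(S, ā) 𝒪ⁿ / ϖ 𝒪ⁿ` of `𝓀ⁿ`. [folklore] -/
theorem isIntegralMatrix_inv_heckeRepMatrix_mul_iff {ϖ : F} (hϖ : IsUniformizingElement ϖ)
    {S : Finset (Fin n)} {ā : Fin n → Fin n → 𝓀[F]} (hd : IsEchelonData S ā)
    (w₀ : Matrix (Fin n) (Fin n) 𝒪[F]) :
    IsIntegralMatrix ((heckeRepMatrix ϖ S ā)⁻¹ * w₀.map (𝒪[F]).subtype) ↔
      ∀ j, (fun i => (w₀.map (IsLocalRing.residue 𝒪[F])) i j) ∈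
        Submodule.span 𝓀[F] (echelonVec ā '' (S : Set (Fin n))) := by
  -- the entries of `rep⁻¹ w₀`
  set N₀ : Matrix (Fin n) (Fin n) 𝒪[F] := negEchelonModel ā * w₀ with hN₀
  have hN : echelonMatrix (-liftTable ā) * w₀.map (𝒪[F]).subtype = N₀.map (𝒪[F]).subtype := by
    rw [hN₀, ← map_negEchelonModel, Matrix.map_mul]
  have hentry : ∀ i j, ((heckeRepMatrix ϖ S ā)⁻¹ * w₀.map (𝒪[F]).subtype) i j =
      (ϖ ^ epsOf S i)⁻¹ * (N₀ i j : F) := by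
    intro i j
    have h1 := inv_heckeRepMatrix_mul_apply hϖ.ne_zero hd (w₀.map (𝒪[F]).subtype)
      (fun _ => (1 : F)) i j
    rw [Matrix.diagonal_one, Matrix.mul_one, mul_one, hN] at h1
    exact h1
  -- residues of `N₀ = u_{-a} w₀`
  have hres : N₀.map (IsLocalRing.residue 𝒪[F]) =
      echelonMatrix (-ā) * w₀.map (IsLocalRing.residue 𝒪[F]) := by
    rw [hN₀, Matrix.map_mul, residue_map_negEchelonModel]
  have hres' : ∀ i j, IsLocalRing.residue 𝒪[F] (N₀ i j) =
      (echelonMatrix (-ā) *ᵥ fun i => (w₀.map (IsLocalRing.residue 𝒪[F])) i j) i := by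
    intro i j
    have := congrFun (congrFun hres i) j
    rw [Matrix.map_apply] at this
    rw [this, Matrix.mul_apply, Matrix.mulVec, dotProduct]
  simp_rw [mem_span_echelonVec_iff hd, ← hres']
  constructor
  · intro hint j i hi
    have h := hint i j
    rw [hentry, epsOf_of_not_mem hi, pow_one, hϖ.inv_mul_mem_iff] at h
    exact h
  · intro h i j
    rw [hentry]
    by_cases hi : i ∈ S
    · rw [epsOf_of_mem hi, pow_zero, inv_one, one_mul]
      exact (N₀ i j).2
    · rw [epsOf_of_not_mem hi, pow_one, hϖ.inv_mul_mem_iff]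
      exact h j i hi

/-! ### Left cosets of `K t_r K` dominating a given integral matrix, counted by subspaces -/

/-- Left multiplication by `κ ∈ GL_n(𝒪)` preserves integrality of matrices. [folklore] -/
theorem isIntegralMatrix_glInt_mul_iff {κ : GL (Fin n) F} (hκ : κ ∈ glInt n F)
    (M : Matrix (Fin n) (Fin n) F) :
    IsIntegralMatrix ((κ : Matrix (Fin n) (Fin n) F) * M) ↔ IsIntegralMatrix M := by
  refine ⟨fun h => ?_, fun h => (isIntegralMatrix_of_mem_glInt hκ).mul h⟩
  have e : M = ((κ⁻¹ : GL (Fin n) F) : Matrix (Fin n) (Fin n) F) *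
      ((κ : Matrix (Fin n) (Fin n) F) * M) := by
    rw [← Matrix.mul_assoc, ← Units.val_mul, inv_mul_cancel, Units.val_one, Matrix.one_mul]
  rw [e]
  exact (isIntegralMatrix_inv_of_mem_glInt hκ).mul h

/-- The span of the echelon vectors of reduced echelon data `(S, a)` has dimension `#S`.
[folklore] -/
theorem _root_.Literature.LinearAlgebra.Matrix.Echelon.IsEchelonData.finrank_span_eq_card
    {k : Type*} [Field k] {S : Finset (Fin n)} {a : Fin n → Fin n → k} (h : IsEchelonData S a) :
    Module.finrank k (Submodule.span k (echelonVec a '' (S : Set (Fin n)))) = S.card := by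
  have h2 : Set.range (fun j : S => echelonVec a j) = echelonVec a '' (S : Set (Fin n)) := by
    ext y; simp
  rw [← h2, _root_.finrank_span_eq_card (R := k) h.linearIndependent, Fintype.card_coe]

/-- **Reduced echelon data ↔ subspaces of `𝓀ⁿ` of dimension `#S`**: the span map from the index
set `TransversalIndex n F r` (pivot sets of size `n - r` with their reduced echelon tables) to the
subspaces of `𝓀ⁿ` of dimension `n - r` is a bijection (existence and uniqueness of reduced
echelon bases, `exists_echelon_basis`, `IsEchelonData.unique`). [folklore] -/
theorem bijective_transversalIndex_span (r : ℕ) :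
    Function.Bijective (fun p : TransversalIndex n F r =>
      (⟨Submodule.span 𝓀[F] (echelonVec p.1.2 '' (p.1.1 : Set (Fin n))),
          by rw [p.2.2.finrank_span_eq_card, p.2.1]⟩ :
        {Y : Submodule 𝓀[F] (Fin n → 𝓀[F]) // Module.finrank 𝓀[F] Y = n - r})) := by
  constructor
  · rintro ⟨⟨S, ā⟩, hS, h⟩ ⟨⟨S', ā'⟩, hS', h'⟩ hpp
    simp only [Subtype.mk.injEq] at hpp
    obtain ⟨rfl, rfl⟩ := h.unique h' hpp
    rfl
  · rintro ⟨Y, hY⟩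
    obtain ⟨S, ā, hd, hspan, -, hcard⟩ := exists_echelon_basis Y
    rw [hY] at hcard
    exact ⟨⟨(S, ā), hcard, hd⟩, Subtype.ext hspan⟩

/-- The index set `TransversalIndex n F r` is in bijection with the transversal
`heckeTransversal` (as a set), by `rep`. [folklore] -/
theorem bijective_transversalIndex_rep [Finite 𝓀[F]] {ϖ : F} (hϖ : IsUniformizingElement ϖ)
    (r : ℕ) :
    Function.Bijective (fun p : TransversalIndex n F r =>
      (⟨p.rep hϖ.ne_zero, (mem_heckeTransversal_iff hϖ.ne_zero).mpr ⟨p, rfl⟩⟩ :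
        ((heckeTransversal (n := n) hϖ.ne_zero r : Finset (GL (Fin n) F)) :
          Set (GL (Fin n) F)))) := by
  constructor
  · intro p p' h
    exact TransversalIndex.rep_injective hϖ (congrArg Subtype.val h)
  · rintro ⟨y, hy⟩
    obtain ⟨p, rfl⟩ := (mem_heckeTransversal_iff hϖ.ne_zero).mp hy
    exact ⟨p, rfl⟩

/-- For `y` in the transversal of `K t_r K / K`, integrality of `(y K).out⁻¹ w` is integrality of
`y⁻¹ w` (the two differ by a factor in `K = GL_n(𝒪)` on the left). [folklore] -/
theorem isIntegralMatrix_out_inv_mul_iff {y : GL (Fin n) F} (w : GL (Fin n) F) :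
    IsIntegralMatrix ((((y : GL (Fin n) F ⧸ glInt n F).out)⁻¹ * w : GL (Fin n) F) :
        Matrix (Fin n) (Fin n) F) ↔
      IsIntegralMatrix ((y⁻¹ * w : GL (Fin n) F) : Matrix (Fin n) (Fin n) F) := by
  obtain ⟨κ, hκ⟩ := QuotientGroup.mk_out_eq_mul (glInt n F) y
  rw [hκ, _root_.mul_inv_rev, mul_assoc, Units.val_mul]
  exact isIntegralMatrix_glInt_mul_iff (Subgroup.inv_mem _ κ.2) _

/-- **Counting the left cosets of `K t_r K` above an integral matrix by subspaces.** Let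
`w = w₀` be an integral matrix in `GL_n(F)` and `C(w̄₀) ≤ 𝓀ⁿ` the span of the columns of its
residue matrix. The left cosets `y K ⊆ K t_r K` (`K = GL_n(𝒪)`, `t_r = diag(ϖ 1_r, 1_{n-r})`) with
`y⁻¹ w` integral — i.e. the lattices `y 𝒪ⁿ ⊇ w 𝒪ⁿ` with `𝒪ⁿ / y 𝒪ⁿ ≅ 𝓀^r` — are equinumerous
with the subspaces `Y ≤ 𝓀ⁿ` of dimension `n - r` containing `C(w̄₀)` (through
`y 𝒪ⁿ ↦ y 𝒪ⁿ / ϖ 𝒪ⁿ`; here via the transversal `{u_a ϖ^{ε_S}}` of `HeckeTransversalGL`, the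
reduced echelon parametrisation of subspaces, and `isIntegralMatrix_inv_heckeRepMatrix_mul_iff`).
This is the lattice count in the proof of Shimura (1971), Lemma 3.22. [folklore] -/
theorem ncard_orbit_heckeDiag_isIntegralMatrix [Finite 𝓀[F]] {ϖ : F} (hϖ : IsUniformizingElement ϖ)
    {r : ℕ} (hr : r ≤ n) (w₀ : Matrix (Fin n) (Fin n) 𝒪[F]) {w : GL (Fin n) F}
    (hw : (w : Matrix (Fin n) (Fin n) F) = w₀.map (𝒪[F]).subtype) :
    {α ∈ MulAction.orbit (glInt n F)
        ((heckeDiag n (Units.mk0 ϖ hϖ.ne_zero) r : GL (Fin n) F) : GL (Fin n) F ⧸ glInt n F) |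
      IsIntegralMatrix (((α.out)⁻¹ * w : GL (Fin n) F) : Matrix (Fin n) (Fin n) F)}.ncard =
    Nat.card {Y : Submodule 𝓀[F] (Fin n → 𝓀[F]) // Module.finrank 𝓀[F] Y = n - r ∧
      Submodule.span 𝓀[F] (Set.range fun j => fun i =>
        IsLocalRing.residue 𝒪[F] (w₀ i j)) ≤ Y} := by
  classical
  -- notation
  set t : GL (Fin n) F := heckeDiag n (Units.mk0 ϖ hϖ.ne_zero) r with ht
  set P : (GL (Fin n) F ⧸ glInt n F) → Prop := fun α =>
    IsIntegralMatrix (((α.out)⁻¹ * w : GL (Fin n) F) : Matrix (Fin n) (Fin n) F) with hP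
  set C : Submodule 𝓀[F] (Fin n → 𝓀[F]) :=
    Submodule.span 𝓀[F] (Set.range fun j => fun i => IsLocalRing.residue 𝒪[F] (w₀ i j)) with hC
  -- the three bijections: transversal ≃ orbit, index set ≃ transversal, index set ≃ subspaces
  set e₁ := (bijOn_heckeTransversal (n := n) hϖ hr).equiv _ with he₁
  set e₀ := Equiv.ofBijective _ (bijective_transversalIndex_rep (n := n) hϖ r) with he₀
  set e₂ := Equiv.ofBijective _ (bijective_transversalIndex_span (n := n) (F := F) r) with he₂
  -- the predicate along `e₁ ∘ e₀`: `(yK).out⁻¹ w` integral iff the columns of `w̄₀` lie in `span`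
  have key : ∀ p : TransversalIndex n F r, P (e₁ (e₀ p)).1 ↔ C ≤ (e₂ p).1 := by
    intro p
    change IsIntegralMatrix ((((p.rep hϖ.ne_zero : GL (Fin n) F) : GL (Fin n) F ⧸ glInt n F).out⁻¹ *
        w : GL (Fin n) F) : Matrix (Fin n) (Fin n) F) ↔
      C ≤ Submodule.span 𝓀[F] (echelonVec p.1.2 '' (p.1.1 : Set (Fin n)))
    rw [isIntegralMatrix_out_inv_mul_iff, Units.val_mul, Matrix.coe_units_inv, hw, hC,
      Submodule.span_le, Set.range_subset_iff]
    exact isIntegralMatrix_inv_heckeRepMatrix_mul_iff hϖ p.2.2 w₀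
  calc {α ∈ MulAction.orbit (glInt n F) (t : GL (Fin n) F ⧸ glInt n F) | P α}.ncard
      = Nat.card {α : MulAction.orbit (glInt n F) (t : GL (Fin n) F ⧸ glInt n F) // P α.1} := by
        rw [← Nat.card_coe_set_eq]
        exact Nat.card_congr (Equiv.Set.sep _ _)
    _ = Nat.card {p : TransversalIndex n F r // P (e₁ (e₀ p)).1} :=
        (Nat.card_congr ((e₀.trans e₁).subtypeEquiv fun p => Iff.rfl)).symm
    _ = Nat.card {p : TransversalIndex n F r // C ≤ (e₂ p).1} :=
        Nat.card_congr (Equiv.subtypeEquivRight key)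
    _ = Nat.card {Y : {Y : Submodule 𝓀[F] (Fin n → 𝓀[F]) // Module.finrank 𝓀[F] Y = n - r} //
          C ≤ Y.1} := Nat.card_congr (e₂.subtypeEquiv fun p => Iff.rfl)
    _ = _ := Nat.card_congr (Equiv.subtypeSubtypeEquivSubtypeInter _ _)

/-! ### Integral matrices of given determinant valuation: `Δ_m` -/

section Delta

variable {ϖ : F}

/-- `det t_r` has valuation `|ϖ|^r`. [folklore] -/
theorem valuation_det_heckeDiag (ϖ' : Fˣ) {r : ℕ} (hr : r ≤ n) :
    valuation F ((heckeDiag n ϖ' r : GL (Fin n) F) : Matrix (Fin n) (Fin n) F).det =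
      valuation F (ϖ' : F) ^ r := by
  rw [det_heckeDiag_coe _ hr, map_pow]

/-- `t_r = diag(ϖ 1_r, 1_{n-r})` is an integral matrix for `ϖ ∈ 𝒪`. [folklore] -/
theorem isIntegralMatrix_heckeDiag {ϖ' : Fˣ} (hϖ' : (ϖ' : F) ∈ 𝒪[F]) (r : ℕ) :
    IsIntegralMatrix ((heckeDiag n ϖ' r : GL (Fin n) F) : Matrix (Fin n) (Fin n) F) := by
  intro i j
  rw [coe_heckeDiag, Matrix.diagonal_apply]
  split_ifs
  · exact hϖ'
  · exact Subring.one_mem _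
  · exact Subring.zero_mem _

/-- The valuation of `det (y⁻¹ w)`. [folklore] -/
theorem valuation_det_inv_mul (y w : GL (Fin n) F) :
    valuation F ((y⁻¹ * w : GL (Fin n) F) : Matrix (Fin n) (Fin n) F).det =
      (valuation F (y : Matrix (Fin n) (Fin n) F).det)⁻¹ *
        valuation F (w : Matrix (Fin n) (Fin n) F).det := by
  rw [← Matrix.GeneralLinearGroup.val_det_apply, ← Matrix.GeneralLinearGroup.val_det_apply,
    ← Matrix.GeneralLinearGroup.val_det_apply, map_mul, map_inv, Units.val_mul,
    Units.val_inv_eq_inv_val, map_mul, map_inv₀]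

/-- The valuation of `det (y w)`. [folklore] -/
theorem valuation_det_mul (y w : GL (Fin n) F) :
    valuation F ((y * w : GL (Fin n) F) : Matrix (Fin n) (Fin n) F).det =
      valuation F (y : Matrix (Fin n) (Fin n) F).det *
        valuation F (w : Matrix (Fin n) (Fin n) F).det := by
  rw [Units.val_mul, Matrix.det_mul, map_mul]

/-- Membership in `Δ_m = {y integral, |det y| = |ϖ|^m}` is invariant under `K = GL_n(𝒪)` on the
left. [folklore] -/
theorem glInt_mul_mem_delta_iff {κ : GL (Fin n) F} (hκ : κ ∈ glInt n F) (y : GL (Fin n) F)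
    (m : ℕ) :
    (IsIntegralMatrix ((κ * y : GL (Fin n) F) : Matrix (Fin n) (Fin n) F) ∧
        valuation F ((κ * y : GL (Fin n) F) : Matrix (Fin n) (Fin n) F).det =
          valuation F ϖ ^ m) ↔
      (IsIntegralMatrix (y : Matrix (Fin n) (Fin n) F) ∧
        valuation F (y : Matrix (Fin n) (Fin n) F).det = valuation F ϖ ^ m) := by
  rw [valuation_det_mul, valuation_det_eq_one_of_mem_glInt hκ, one_mul, Units.val_mul,
    isIntegralMatrix_glInt_mul_iff hκ]

/-- Membership in `Δ_m` is invariant under `K = GL_n(𝒪)` on the right. [folklore] -/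
theorem mul_glInt_mem_delta_iff {κ : GL (Fin n) F} (hκ : κ ∈ glInt n F) (y : GL (Fin n) F)
    (m : ℕ) :
    (IsIntegralMatrix ((y * κ : GL (Fin n) F) : Matrix (Fin n) (Fin n) F) ∧
        valuation F ((y * κ : GL (Fin n) F) : Matrix (Fin n) (Fin n) F).det =
          valuation F ϖ ^ m) ↔
      (IsIntegralMatrix (y : Matrix (Fin n) (Fin n) F) ∧
        valuation F (y : Matrix (Fin n) (Fin n) F).det = valuation F ϖ ^ m) := by
  rw [valuation_det_mul, valuation_det_eq_one_of_mem_glInt hκ, mul_one, Units.val_mul]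
  refine and_congr_left fun _ => ⟨fun h => ?_, fun h => h.mul (isIntegralMatrix_of_mem_glInt hκ)⟩
  have e : (y : Matrix (Fin n) (Fin n) F) = (y : Matrix (Fin n) (Fin n) F) * κ *
      ((κ⁻¹ : GL (Fin n) F) : Matrix (Fin n) (Fin n) F) := by
    rw [Matrix.mul_assoc, ← Units.val_mul, mul_inv_cancel, Units.val_one, Matrix.mul_one]
  rw [e]
  exact h.mul (isIntegralMatrix_inv_of_mem_glInt hκ)

/-- `Δ_0 = K`: an integral matrix with unit determinant lies in `GL_n(𝒪)`, and conversely.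
[folklore] -/
theorem mem_delta_zero_iff (y : GL (Fin n) F) :
    (IsIntegralMatrix (y : Matrix (Fin n) (Fin n) F) ∧
        valuation F (y : Matrix (Fin n) (Fin n) F).det = valuation F ϖ ^ 0) ↔ y ∈ glInt n F := by
  rw [pow_zero]
  exact ⟨fun h => mem_glInt_of_isIntegralMatrix h.1 h.2, fun h =>
    ⟨isIntegralMatrix_of_mem_glInt h, valuation_det_eq_one_of_mem_glInt h⟩⟩

/-- Representatives of the cosets in `K t_r K / K` lie in `Δ_r`. [folklore] -/
theorem out_mem_delta_of_mem_orbit (hϖ : IsUniformizingElement ϖ) {r : ℕ} (hr : r ≤ n)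
    {α : GL (Fin n) F ⧸ glInt n F}
    (hα : α ∈ MulAction.orbit (glInt n F)
      ((heckeDiag n (Units.mk0 ϖ hϖ.ne_zero) r : GL (Fin n) F) : GL (Fin n) F ⧸ glInt n F)) :
    IsIntegralMatrix ((α.out : GL (Fin n) F) : Matrix (Fin n) (Fin n) F) ∧
      valuation F ((α.out : GL (Fin n) F) : Matrix (Fin n) (Fin n) F).det = valuation F ϖ ^ r := by
  obtain ⟨κ, rfl⟩ := (mem_orbit_mk_iff (glInt n F)).1 hα
  obtain ⟨κ', hκ'⟩ := QuotientGroup.mk_out_eq_mul (glInt n F)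
    ((κ : GL (Fin n) F) * heckeDiag n (Units.mk0 ϖ hϖ.ne_zero) r)
  rw [hκ', mul_glInt_mem_delta_iff κ'.2, glInt_mul_mem_delta_iff κ.2]
  exact ⟨isIntegralMatrix_heckeDiag (by exact hϖ.mem) r, valuation_det_heckeDiag _ hr⟩

/-- **Quotients.** If `y ∈ Δ_i`, `w ∈ Δ_{i+j}` and `y⁻¹ w` is integral, then `y⁻¹ w ∈ Δ_j`.
[folklore] -/
theorem inv_mul_mem_delta (hϖ : IsUniformizingElement ϖ) {y w : GL (Fin n) F} {i j : ℕ}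
    (hy : valuation F (y : Matrix (Fin n) (Fin n) F).det = valuation F ϖ ^ i)
    (hw : valuation F (w : Matrix (Fin n) (Fin n) F).det = valuation F ϖ ^ (i + j))
    (hint : IsIntegralMatrix ((y⁻¹ * w : GL (Fin n) F) : Matrix (Fin n) (Fin n) F)) :
    IsIntegralMatrix ((y⁻¹ * w : GL (Fin n) F) : Matrix (Fin n) (Fin n) F) ∧
      valuation F ((y⁻¹ * w : GL (Fin n) F) : Matrix (Fin n) (Fin n) F).det =
        valuation F ϖ ^ j := by
  refine ⟨hint, ?_⟩
  have hv : valuation F ϖ ≠ 0 := (Valuation.ne_zero_iff _).mpr hϖ.ne_zero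
  rw [valuation_det_inv_mul, hy, hw, pow_add, ← mul_assoc, inv_mul_cancel₀ (pow_ne_zero _ hv),
    one_mul]

/-- **No integral quotient of too small a determinant.** If `|det y| = |ϖ|^i` with `i > m` and
`|det w| = |ϖ|^m`, then `y⁻¹ w` is not integral (its determinant has valuation `|ϖ|^{m-i} > 1`).
[folklore] -/
theorem not_isIntegralMatrix_inv_mul (hϖ : IsUniformizingElement ϖ) {y w : GL (Fin n) F}
    {i m : ℕ} (him : m < i)
    (hy : valuation F (y : Matrix (Fin n) (Fin n) F).det = valuation F ϖ ^ i)
    (hw : valuation F (w : Matrix (Fin n) (Fin n) F).det = valuation F ϖ ^ m) :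
    ¬ IsIntegralMatrix ((y⁻¹ * w : GL (Fin n) F) : Matrix (Fin n) (Fin n) F) := by
  intro hint
  have h1 := (Valuation.mem_integer_iff _ _).mp hint.det_mem
  have hv : valuation F ϖ ≠ 0 := (Valuation.ne_zero_iff _).mpr hϖ.ne_zero
  rw [valuation_det_inv_mul, hy, hw] at h1
  -- `|ϖ|^{-i} |ϖ|^m ≤ 1` forces `i ≤ m`
  have h2 : valuation F ϖ ^ m ≤ valuation F ϖ ^ i := by
    have := mul_le_mul_right h1 (valuation F ϖ ^ i)
    rwa [← mul_assoc, mul_inv_cancel₀ (pow_ne_zero _ hv), one_mul, mul_one] at this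
  have h3 : valuation F ϖ ^ i < valuation F ϖ ^ m :=
    pow_lt_pow_right_of_lt_one₀ ((Valuation.pos_iff _).mpr hϖ.ne_zero) hϖ.valuation_lt_one him
  exact absurd h2 (not_le.mpr h3)

/-- Products: `Δ_i Δ_j ⊆ Δ_{i+j}`. [folklore] -/
theorem mul_mem_delta {y z : GL (Fin n) F} {i j : ℕ}
    (hy : IsIntegralMatrix (y : Matrix (Fin n) (Fin n) F) ∧
      valuation F (y : Matrix (Fin n) (Fin n) F).det = valuation F ϖ ^ i)
    (hz : IsIntegralMatrix (z : Matrix (Fin n) (Fin n) F) ∧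
      valuation F (z : Matrix (Fin n) (Fin n) F).det = valuation F ϖ ^ j) :
    IsIntegralMatrix ((y * z : GL (Fin n) F) : Matrix (Fin n) (Fin n) F) ∧
      valuation F ((y * z : GL (Fin n) F) : Matrix (Fin n) (Fin n) F).det =
        valuation F ϖ ^ (i + j) := by
  rw [valuation_det_mul, hy.2, hz.2, ← pow_add, Units.val_mul]
  exact ⟨hy.1.mul hz.1, rfl⟩

/-- **The residue of a matrix in `Δ_m`, `m ≥ 1`, is singular**: the columns of `w̄₀` span a
proper subspace of `𝓀ⁿ` (otherwise `w̄₀` would be invertible and `det w₀` a unit). [folklore] -/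
theorem span_cols_residue_ne_top (hϖ : IsUniformizingElement ϖ) {m : ℕ} (hm : 1 ≤ m)
    (w₀ : Matrix (Fin n) (Fin n) 𝒪[F])
    (hw : valuation F (w₀.map (𝒪[F]).subtype).det = valuation F ϖ ^ m) :
    Submodule.span 𝓀[F] (Set.range fun j => fun i => IsLocalRing.residue 𝒪[F] (w₀ i j)) ≠ ⊤ := by
  classical
  intro htop
  -- the columns of the residue matrix are then linearly independent, so it is invertible
  set wb : Matrix (Fin n) (Fin n) 𝓀[F] := w₀.map (IsLocalRing.residue 𝒪[F]) with hwb
  have hcols : (fun j => fun i => IsLocalRing.residue 𝒪[F] (w₀ i j)) = wb.col := by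
    funext j i; rfl
  rw [hcols] at htop
  have hli : LinearIndependent 𝓀[F] wb.col :=
    linearIndependent_of_top_le_span_of_card_eq_finrank htop.ge
      (by rw [Fintype.card_fin, Module.finrank_fin_fun])
  have hunit : IsUnit wb := (Matrix.linearIndependent_cols_iff_isUnit).mp hli
  rw [Matrix.isUnit_iff_isUnit_det, hwb, ← RingHom.mapMatrix_apply, ← RingHom.map_det] at hunit
  -- so `det w₀` is a unit of `𝒪`, contradicting `|det w₀| = |ϖ|^m < 1`
  have hres : IsLocalRing.residue 𝒪[F] w₀.det ≠ 0 := hunit.ne_zero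
  have hlt : valuation F ((w₀.det : 𝒪[F]) : F) < 1 := by
    have e : ((w₀.det : 𝒪[F]) : F) = (w₀.map (𝒪[F]).subtype).det := by
      rw [← RingHom.mapMatrix_apply, ← RingHom.map_det]; rfl
    rw [e, hw]
    exact pow_lt_one₀ zero_le hϖ.valuation_lt_one (by omega)
  exact hres (residue_eq_zero_of_valuation_lt_one hlt)

end Delta

/-! ### The Hecke polynomial in Satake form -/

section Polynomials

/-- `e_0(s) = 1`. [folklore] -/
theorem multiset_esymm_zero_right {R : Type*} [CommSemiring R] (s : Multiset R) : s.esymm 0 = 1 := by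
  simp [Multiset.esymm, Multiset.powersetCard_zero_left]

/-- `e_{j+1}(a ∷ s) = e_{j+1}(s) + a e_j(s)`. [folklore] -/
theorem multiset_esymm_cons_succ {R : Type*} [CommSemiring R] (a : R) (s : Multiset R) (j : ℕ) :
    (a ::ₘ s).esymm (j + 1) = s.esymm (j + 1) + a * s.esymm j := by
  simp only [Multiset.esymm, Multiset.powersetCard_cons, Multiset.map_add, Multiset.sum_add,
    Multiset.map_map, Function.comp_def, Multiset.prod_cons]
  rw [← Multiset.sum_map_mul_left]

/-- `e_j(s) = 0` for `j > #s`. [folklore] -/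
theorem multiset_esymm_eq_zero_of_card_lt {R : Type*} [CommSemiring R] (s : Multiset R) {j : ℕ}
    (h : Multiset.card s < j) : s.esymm j = 0 := by
  simp [Multiset.esymm, Multiset.powersetCard_eq_empty _ h]

/-- `∏_{b ∈ s} (1 + b X) = ∑_j e_j(s) X^j` (the reciprocal form of Vieta's formula, cf. Mathlib's
`Multiset.prod_X_add_C_eq_sum_esymm`). [folklore] -/
theorem multiset_prod_one_add_C_mul_X_eq_sum_esymm {R : Type*} [CommSemiring R] (s : Multiset R) :
    (s.map fun b => (1 : Polynomial R) + Polynomial.C b * Polynomial.X).prod =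
      ∑ j ∈ Finset.range (Multiset.card s + 1), Polynomial.C (s.esymm j) * Polynomial.X ^ j := by
  induction s using Multiset.induction_on with
  | empty => simp [multiset_esymm_zero_right]
  | cons a s ih =>
    rw [Multiset.map_cons, Multiset.prod_cons, ih, Multiset.card_cons]
    set A : Polynomial R := ∑ j ∈ Finset.range (Multiset.card s + 1),
      Polynomial.C (s.esymm (j + 1)) * Polynomial.X ^ (j + 1) with hA
    have hA' : A = ∑ j ∈ Finset.range (Multiset.card s),
        Polynomial.C (s.esymm (j + 1)) * Polynomial.X ^ (j + 1) := by
      rw [hA, Finset.sum_range_succ, multiset_esymm_eq_zero_of_card_lt s (Nat.lt_succ_self _),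
        map_zero, zero_mul, add_zero]
    have hQ : ∑ j ∈ Finset.range (Multiset.card s + 1), Polynomial.C (s.esymm j) *
        Polynomial.X ^ j = A + 1 := by
      rw [hA', Finset.sum_range_succ' (fun j => Polynomial.C (s.esymm j) * Polynomial.X ^ j),
        multiset_esymm_zero_right, map_one, pow_zero, mul_one]
    have hR : ∑ j ∈ Finset.range (Multiset.card s + 1 + 1),
        Polynomial.C ((a ::ₘ s).esymm j) * Polynomial.X ^ j =
        A + Polynomial.C a * Polynomial.X * ∑ j ∈ Finset.range (Multiset.card s + 1),
          Polynomial.C (s.esymm j) * Polynomial.X ^ j + 1 := by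
      rw [Finset.sum_range_succ', multiset_esymm_zero_right, map_one, pow_zero, mul_one]
      simp only [multiset_esymm_cons_succ, map_add, map_mul, add_mul, Finset.sum_add_distrib]
      rw [hA, Finset.mul_sum]
      congr 2
      refine Finset.sum_congr rfl fun j _ => ?_
      ring
    rw [hR, hQ]
    ring

/-- `∏_{b ∈ s} (1 - b X) = ∑_j (-1)^j e_j(s) X^j`. [folklore] -/
theorem multiset_prod_one_sub_C_mul_X_eq_sum_esymm {R : Type*} [CommRing R] (s : Multiset R) :
    (s.map fun b => (1 : Polynomial R) - Polynomial.C b * Polynomial.X).prod =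
      ∑ j ∈ Finset.range (Multiset.card s + 1),
        Polynomial.C ((-1) ^ j * s.esymm j) * Polynomial.X ^ j := by
  have h := multiset_prod_one_add_C_mul_X_eq_sum_esymm (s.map Neg.neg)
  rw [Multiset.map_map, Multiset.card_map] at h
  simp_rw [Multiset.esymm_neg] at h
  rw [← h]
  congr 1
  refine Multiset.map_congr rfl fun b _ => ?_
  simp [sub_eq_add_neg]

/-- The exponent bookkeeping of Tamagawa's identity: `i(i-1) + i(n-i) = (n-1) i` for `i ≤ n`
(here with `i(i-1) = 2 binom(i, 2)`). [folklore] -/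
theorem two_mul_choose_two_add_mul_sub (n i : ℕ) (hi : i ≤ n) :
    2 * i.choose 2 + i * (n - i) = (n - 1) * i := by
  have h2 : 2 * i.choose 2 = i * (i - 1) := by
    rcases i with _ | i
    · simp
    · have := Nat.add_one_mul_choose_eq i 1
      rw [Nat.choose_one_right] at this
      simp only [Nat.add_sub_cancel]
      linarith
  rw [h2]
  rcases i with _ | i
  · simp
  · have e : i + (n - (i + 1)) = n - 1 := by omega
    calc (i + 1) * (i + 1 - 1) + (i + 1) * (n - (i + 1)) = (i + 1) * (i + (n - (i + 1))) := by
          rw [Nat.add_sub_cancel]; ring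
      _ = (n - 1) * (i + 1) := by rw [e]; ring

/-- **The Hecke polynomial in Satake form (Tamagawa).** If `τ_i = q^{i(n-i)/2} e_i(α)` for
`i ≤ n` (the unitary Satake normalisation of `IsSatakeParameter`, `#α = n`), then
`∑_{i=0}^{n} (-1)^i q^{i(i-1)/2} τ_i X^i = ∏_{a ∈ α} (1 - q^{(n-1)/2} a X)`, because
`i(i-1)/2 + i(n-i)/2 = i(n-1)/2` and `e_i(c • α) = c^i e_i(α)` — pure algebra (Tamagawa (1963);
Shimura (1971), Thm. 3.21 with (3.2.3) for the degenerate case `α = {1, q, …, q^{n-1}}·q^{-(n-1)/2}`;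
the tree's named fact `heckePolynomial_eq_satakePolynomial` of `SatakeParametersGL` is the same
identity for the reciprocal polynomial `∑ (-1)^i q^{i(i-1)/2} τ_i X^{n-i}`). [folklore] -/
theorem heckePolynomial_eq_prod_one_sub (q n : ℕ) (α : Multiset ℂ) (hα : Multiset.card α = n) :
    ∑ i ∈ Finset.range (n + 1), Polynomial.C ((-1 : ℂ) ^ i * (q : ℂ) ^ i.choose 2 *
        (((Real.sqrt q : ℝ) : ℂ) ^ (i * (n - i)) * α.esymm i)) * Polynomial.X ^ i =
      (α.map fun a => (1 : Polynomial ℂ) -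
        Polynomial.C (((Real.sqrt q : ℝ) : ℂ) ^ (n - 1) * a) * Polynomial.X).prod := by
  set c : ℂ := ((Real.sqrt q : ℝ) : ℂ) ^ (n - 1) with hc
  have hprod : (α.map fun a => (1 : Polynomial ℂ) - Polynomial.C (c * a) * Polynomial.X).prod =
      ((α.map (c * ·)).map fun b => (1 : Polynomial ℂ) - Polynomial.C b * Polynomial.X).prod := by
    rw [Multiset.map_map]; rfl
  rw [hprod, multiset_prod_one_sub_C_mul_X_eq_sum_esymm, Multiset.card_map, hα]
  refine Finset.sum_congr rfl fun i hi => ?_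
  rw [Finset.mem_range, Nat.lt_succ_iff] at hi
  congr 2
  -- `e_i(c • α) = c^i e_i(α)` and `q^{C(i,2)} (√q)^{i(n-i)} = c^i`
  have hes : (α.map (c * ·)).esymm i = c ^ i * α.esymm i := by
    have := Multiset.pow_smul_esymm c i α
    simp only [smul_eq_mul] at this
    rw [← this]
  have hq : (q : ℂ) = ((Real.sqrt q : ℝ) : ℂ) ^ 2 := by
    rw [← Complex.ofReal_pow, Real.sq_sqrt (Nat.cast_nonneg q)]; simp
  rw [hes, hq, ← pow_mul, hc, ← pow_mul, ← two_mul_choose_two_add_mul_sub n i hi, pow_add]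
  ring

end Polynomials

end Literature.NumberTheory.Automorphic
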